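/-
Copyright (c) 2026 the pub-hodgecm-mathlib formalisation cell (harness21).  Prover seat hodgecm-mathlib-K2E3-p21 (g7), HCML Track B «K2-LIT» ∕ h413
(`stmt-HodgeConjecture-24833`), line `K2_E3_EllipticInputs`, leaf (nsc-S-A′), brick (E4b) = discharge of `h3cell` of ★ E4a, part (E4b-1β) MIDDLE CELL, file 1:
the integrand of the middle-cell Haar functional and its symmetries (architect K2E3-p25 (g2) «NCQ dévissage», bus 2026-09-04 12:00Z∕12:16Z; consumer letter L1 of
K2E3-p03 (E4b-3), bus 12:12Z).  2026-09-04.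
-/
import Summits.HodgeConjecture.HodgeConjecture.Theorems.K2E3GL3BruhatCellFunctionals           -- ★ E3β (p25 g0): `inducingChar_apply`, `…_of_mem_upperUnitriangular`, ★ E3β₂ coordinates∕Haar (`K2E3GL3BruhatCellHaar`), ★ `K2E3GL3BorelUnipotentHaar.coord_mul`
import Summits.HodgeConjecture.HodgeConjecture.Theorems.K2E3GL3BorelInducedJacquetQFiltration   -- ★ (E4b-1α) (p14): `vanishingOn` currency, `K2E3GL3MaximalParabolicRelabel.mem_standardParabolicGL_iff_entry`
import HarnessLib

/-!
# K2_E3 road (h413), leaf (nsc-S-A′), brick (E4b-1β) file 1 — THE MIDDLE `(B, P_{(2,1)})`-CELL OF `Ind_B^{GL₃} σ′`: THE INTEGRAND `y ↦ f(s₂ · x₁₂(y) · g)`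
# AND ITS SYMMETRIES (unipotent translations, torus scalings, compact support on `X¹ = {f ∣ f|_P = 0}`)

Cell `pub/hodgecm-mathlib` (D-0151), Track B, seat K2E3-p21 (g7).  `--supports stmt-HodgeConjecture-24833 --as helper`; THEOREMS ONLY (no definition ∕ instance ∕
notation ∕ `sorry`); never imports `Cruxes/…/Lines`.  COUNT-NEUTRAL.

THE MATHEMATICS ([BernsteinZelevinsky1977, Thm. 5.2, the middle orbit of `B \ GL₃ ∕ P_{(2,1)}`]; [Casselman1995, §6.3]).  `B = B₃` the upper Borel, `U = U₃` its radical
with coordinates `e((x,y),z) = [[1,x,z],[0,1,y],[0,0,1]]` (★ `exists_coordHomeomorph`), `x₁₂(y) = e((0,y),0)`, `s₂ = permGL (swap 1 2)`, `P = P_{![0,0,1]}`, `U_P` its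
radical (`e((0,y),z)`), `σ′` a character of `B` (here the inducing character `(χ ∘ levi)·δ_B^{1∕2}` of the principal series, ★ `inducingChar_apply`), `I = Ind_B^{GL₃} σ′`.
The middle cell is `C₁ = B s₂ P = U_{α₂} s₂ P`; its cell function is `y ↦ f(s₂ x₁₂(y) g)`.  This file proves the pointwise identities behind the middle-cell
functional `Λ_g(f) = ∫_F f(s₂ x₁₂(y) g) dy` of file 2:
* §1 (algebra in `GL₃`): `s₂ x₁₂(y) e((x,y′),z) = e((z − x(y+y′), 0), x) · s₂ · x₁₂(y + y′)` (`permGL_swap_mul_coordOneTwo_mul_coord`) — right translation by `U` SHIFTS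
  the cell coordinate; `x₁₂(y) · diag(m) = diag(m) · x₁₂(y d₂∕d₁)` (★ `blockDiagonalGL_inv_mul_coord_mul`) — the torus SCALES it.
* §2 (values): `f(s₂ x₁₂(y) u g) = f(s₂ x₁₂(y + u₁₂) g)` for `u ∈ U` (**`toFun_swap_coordOneTwo_mul_unipotent`**, `σ′|_U = 1`);
  `f(s₂ x₁₂(y) diag(m) g) = σ′(s₂ diag(m) s₂⁻¹) f(s₂ x₁₂(y d₂∕d₁) g)` (**`toFun_swap_coordOneTwo_mul_blockDiagonalGL`**).
* §3 (support, continuity): for `f ∈ X¹ = vanishingOn P` and `p ∈ P` the integrand `y ↦ f(s₂ x₁₂(y) p)` is continuous with COMPACT support — the Borel cells below `s₂`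
  lie in `P` (`cellLT id s₂ ⊆ P`, a `decide` on ★ `cellKey`), so `X¹ ≤ vanishingOn (cellLT id s₂)` and ★ E3γ1 `hasCompactSupport_cellFun_of_mem_vanishingOn_cellLT`
  (cell datum of ★ E3β₁ `cellDatum_swap_one_two`) applies, transported along ★ `exists_homeomorph_rootGroup_oneTwo`.
* §4 (integrals, `μ` an additive Haar measure on `F`): translation invariance `∫ f(s₂x₁₂(y) u p) dy = ∫ f(s₂x₁₂(y) p) dy` (`u ∈ U`), hence `U_P`-INVARIANCE
  `∫ (u·f)(s₂x₁₂(y)p) dy = ∫ f(s₂x₁₂(y)p) dy` (`u ∈ U_P`, `p ∈ P`: `p u p⁻¹ ∈ U_P ≤ U`); the torus substitution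
  `∫ f(s₂x₁₂(y) diag(m) p) dy = σ′(s₂ diag m s₂⁻¹) ‖d₁∕d₂‖ ∫ f(s₂x₁₂(y)p) dy` (★ `map_mul_left_addHaar`).
Consumers: file 2 `K2E3GL3BorelInducedJacquetQMiddleCellMap` (the `GL₂`-equivariant map `J₁ → I₂(χ₂)`), file 3 `…MiddleCellKernel` (its kernel is `J₂`).

HONEST LABEL: HC_CM is proved only modulo the 7 printed citations (2 remaining named inputs: hLiu418 = stmt-HodgeConjecture-24832, h413 = stmt-HodgeConjecture-24833) until
rung 0 closes; count-neutral helper.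

## Mathlib ∕ tree search
★ `K2E3GL3BorelUnipotentHaar.coord_mul ∕ coord_inv` · ★ `K2E3GL3BruhatCellHaar.blockDiagonalGL_inv_mul_coord_mul ∕ exists_homeomorph_rootGroup_oneTwo ∕ exists_proj_swap_one_two` ·
★ `K2E3GL3BruhatCellSubgroups.permGL_conj_apply ∕ mem_upperUnitriangular_three_iff ∕ cellDatum_swap_one_two ∕ rootSubgroups_le ∕ coord_apply` · ★ `K2E3GL3BruhatCellFunctionals.inducingChar_apply ∕
…_of_mem_upperUnitriangular ∕ conj_mem_unipotentRadicalGL_of_mem_parabolic` · ★ `K2E3BorelCellCoinvariantsBound.hasCompactSupport_cellFun_of_mem_vanishingOn_cellLT ∕ smoothIndRep_mem_vanishingOn_cellsBelow` ·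
★ `SmoothInd.isLocallyConstant_cellFun` · ★ `map_mul_left_addHaar` · ★ `K2E3GL3MaximalParabolicRelabel.mem_standardParabolicGL_iff_entry ∕ unipotentRadicalGL_eq_bool` · Mathlib `integral_add_right_eq_self`,
`MeasurableEmbedding.integral_map`, `HasCompactSupport.comp_homeomorph`.  Dedup: `lean search 'MiddleCell|swap_coordOneTwo'` — none.

## References
* [BernsteinZelevinsky1977] I. N. Bernstein, A. V. Zelevinsky, *Induced representations of reductive p-adic groups I*, Ann. Sci. ÉNS 10 (1977), 1.7, §2.3, Thm. 5.2.
* [Casselman1995] W. Casselman, *Introduction to the theory of admissible representations of p-adic reductive groups* (draft 1995), §6.3 (Prop. 6.3.1, Thm. 6.3.5).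
-/

set_option autoImplicit false
set_option linter.dupNamespace false

noncomputable section

open Set Function MeasureTheory Measure Representation
open scoped MatrixGroups NNReal ENNReal

namespace Summit.HodgeConjecture.HodgeConjecture.Cruxes.H413.K2E3GL3BorelInducedJacquetQMiddleCellIntegrand

open Literature.NumberTheory.Automorphic ValuativeRel
open Literature.NumberTheory.GaloisRepresentations Literature.NumberTheory.GaloisRepresentations.IsNonarchimedeanLocalField
open Summit.HodgeConjecture.HodgeConjecture.Cruxes.H413.K2E3GL3BorelUnipotentHaar
open Summit.HodgeConjecture.HodgeConjecture.Cruxes.H413.K2E3GL3BruhatCellSubgroups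
open Summit.HodgeConjecture.HodgeConjecture.Cruxes.H413.K2E3GL3BruhatCellHaar
open Summit.HodgeConjecture.HodgeConjecture.Cruxes.H413.K2E3GL3BruhatCellFunctionals
open Summit.HodgeConjecture.HodgeConjecture.Cruxes.H413.K2E3BorelCellJacquetLine
open Summit.HodgeConjecture.HodgeConjecture.Cruxes.H413.K2E3BorelCellCoinvariantsBound

variable {F : Type} [Field F]

/-! ## §1 Algebra in `GL₃`: the cell coordinate under right translation by `U` and by the torus -/

section Algebra

variable [TopologicalSpace F]
  (e : (F × F) × F ≃ₜ ↥(unipotentRadicalGL F (id : Fin 3 → Fin 3)))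
  (he : ∀ p : (F × F) × F, (((e p : ↥(unipotentRadicalGL F (id : Fin 3 → Fin 3))) : GL (Fin 3) F) : Matrix (Fin 3) (Fin 3) F) = !![1, p.1.1, p.2; 0, 1, p.1.2; 0, 0, 1])
include he

/-- Splitting off the cell coordinate: `e((x,y),z) = e((x,0), z − x y) · x₁₂(y)`. [cite: BernsteinZelevinsky1977, §2.1] -/
theorem coord_eq_coordZero_mul_oneTwo (x y z : F) :
    e ((x, y), z) = e ((x, 0), z - x * y) * e ((0, y), 0) := by
  rw [coord_mul e he]
  congr 1
  ext <;> simp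

/-- `x₁₂(y) · e((x,y′),z) = e((x, y + y′), z)`. [cite: BernsteinZelevinsky1977, §2.1] -/
theorem coordOneTwo_mul_coord (y x y' z : F) :
    e ((0, y), 0) * e ((x, y'), z) = e ((x, y + y'), z) := by
  rw [coord_mul e he]
  congr 1
  ext <;> simp

/-- **Conjugating `U ∩ s₂⁻¹ U s₂` by `s₂`**: `s₂ · e((x,0),z) · s₂⁻¹ = e((z,0),x)` (the root groups `(0,1)`, `(0,2)` are exchanged). [cite: BernsteinZelevinsky1977, Thm. 5.2] -/
theorem permGL_swap_mul_coordZero_mul_inv (x z : F) :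
    (permGL (Equiv.swap (1 : Fin 3) 2) : GL (Fin 3) F) * ((e ((x, 0), z) : ↥(unipotentRadicalGL F (id : Fin 3 → Fin 3))) : GL (Fin 3) F) * (permGL (Equiv.swap (1 : Fin 3) 2) : GL (Fin 3) F)⁻¹ =
      ((e ((z, 0), x) : ↥(unipotentRadicalGL F (id : Fin 3 → Fin 3))) : GL (Fin 3) F) := by
  apply Units.ext
  rw [coe_permGL_mul_mul_inv, he, he]
  ext i j
  fin_cases i <;> fin_cases j <;> simp [Matrix.submatrix_apply, Equiv.swap_apply_of_ne_of_ne]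

/-- **THE CELL COORDINATE UNDER RIGHT TRANSLATION BY `U`**: `s₂ · x₁₂(y) · e((x,y′),z) = e((z − x(y+y′), 0), x) · s₂ · x₁₂(y + y′)` — a left factor in `U` (where `σ′ = 1`)
and a SHIFT of the coordinate by `u₁₂ = y′`. [cite: BernsteinZelevinsky1977, Thm. 5.2] -/
theorem permGL_swap_mul_coordOneTwo_mul_coord (y x y' z : F) :
    (permGL (Equiv.swap (1 : Fin 3) 2) : GL (Fin 3) F) * ((e ((0, y), 0) : ↥(unipotentRadicalGL F (id : Fin 3 → Fin 3))) : GL (Fin 3) F) *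
        ((e ((x, y'), z) : ↥(unipotentRadicalGL F (id : Fin 3 → Fin 3))) : GL (Fin 3) F) =
      ((e ((z - x * (y + y'), 0), x) : ↥(unipotentRadicalGL F (id : Fin 3 → Fin 3))) : GL (Fin 3) F) * (permGL (Equiv.swap (1 : Fin 3) 2) : GL (Fin 3) F) *
        ((e ((0, y + y'), 0) : ↥(unipotentRadicalGL F (id : Fin 3 → Fin 3))) : GL (Fin 3) F) := by
  rw [mul_assoc, ← Subgroup.coe_mul, coordOneTwo_mul_coord e he, coord_eq_coordZero_mul_oneTwo e he x (y + y') z, Subgroup.coe_mul, ← mul_assoc,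
    ← permGL_swap_mul_coordZero_mul_inv e he x (z - x * (y + y')), inv_mul_cancel_right]

omit [TopologicalSpace F] he in
/-- `s₂ diag(m) s₂⁻¹ ∈ B` (★ `permGL_conj_blockDiagonalGL_mem_borel`, recorded in the `s₂` spelling). [folklore] -/
theorem permGL_swap_conj_blockDiagonalGL_mem (m : Π a : Fin 3, GL {i : Fin 3 // (id : Fin 3 → Fin 3) i = a} F) :
    (permGL (Equiv.swap (1 : Fin 3) 2) : GL (Fin 3) F) * blockDiagonalGL F (id : Fin 3 → Fin 3) m * (permGL (Equiv.swap (1 : Fin 3) 2) : GL (Fin 3) F)⁻¹ ∈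
      standardParabolicGL F (id : Fin 3 → Fin 3) :=
  permGL_conj_blockDiagonalGL_mem_borel (Equiv.swap (1 : Fin 3) 2) m

/-- **THE CELL COORDINATE UNDER THE TORUS**: `s₂ · x₁₂(y) · diag(m) = (s₂ diag(m) s₂⁻¹) · s₂ · x₁₂(y d₂∕d₁)`, `dᵢ = diag(m)ᵢᵢ`. [cite: BernsteinZelevinsky1977, 1.7] -/
theorem permGL_swap_mul_coordOneTwo_mul_blockDiagonalGL (y : F) (m : Π a : Fin 3, GL {i : Fin 3 // (id : Fin 3 → Fin 3) i = a} F) :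
    (permGL (Equiv.swap (1 : Fin 3) 2) : GL (Fin 3) F) * ((e ((0, y), 0) : ↥(unipotentRadicalGL F (id : Fin 3 → Fin 3))) : GL (Fin 3) F) * blockDiagonalGL F (id : Fin 3 → Fin 3) m =
      ((permGL (Equiv.swap (1 : Fin 3) 2) : GL (Fin 3) F) * blockDiagonalGL F (id : Fin 3 → Fin 3) m * (permGL (Equiv.swap (1 : Fin 3) 2) : GL (Fin 3) F)⁻¹) *
        (permGL (Equiv.swap (1 : Fin 3) 2) : GL (Fin 3) F) *
        ((e ((0, y * ((blockDiagonalGL F (id : Fin 3 → Fin 3) m : GL (Fin 3) F) : Matrix (Fin 3) (Fin 3) F) 2 2 / ((blockDiagonalGL F (id : Fin 3 → Fin 3) m : GL (Fin 3) F) : Matrix (Fin 3) (Fin 3) F) 1 1), 0) :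
          ↥(unipotentRadicalGL F (id : Fin 3 → Fin 3))) : GL (Fin 3) F) := by
  have h := blockDiagonalGL_inv_mul_coord_mul e he m ((0, y), 0)
  simp only [zero_mul, zero_div] at h
  -- `x₁₂(y) diag = diag (diag⁻¹ x₁₂(y) diag)`
  have h2 : ((e ((0, y), 0) : ↥(unipotentRadicalGL F (id : Fin 3 → Fin 3))) : GL (Fin 3) F) * blockDiagonalGL F (id : Fin 3 → Fin 3) m =
      blockDiagonalGL F (id : Fin 3 → Fin 3) m * ((e ((0, y * ((blockDiagonalGL F (id : Fin 3 → Fin 3) m : GL (Fin 3) F) : Matrix (Fin 3) (Fin 3) F) 2 2 / ((blockDiagonalGL F (id : Fin 3 → Fin 3) m : GL (Fin 3) F) : Matrix (Fin 3) (Fin 3) F) 1 1), 0) :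
          ↥(unipotentRadicalGL F (id : Fin 3 → Fin 3))) : GL (Fin 3) F) := by
    rw [← h]; group
  rw [mul_assoc, h2]; group

end Algebra

/-! ## §2 Values of `f ∈ Ind_B σ′` along the middle cell: unipotent shifts and torus scalings -/

section Values

variable [ValuativeRel F] [TopologicalSpace F] [IsNonarchimedeanLocalField F]
  (χ : (Π a : Fin 3, GL {i : Fin 3 // (id : Fin 3 → Fin 3) i = a} F) →* ℂˣ)
  (e : (F × F) × F ≃ₜ ↥(unipotentRadicalGL F (id : Fin 3 → Fin 3)))
  (he : ∀ p : (F × F) × F, (((e p : ↥(unipotentRadicalGL F (id : Fin 3 → Fin 3))) : GL (Fin 3) F) : Matrix (Fin 3) (Fin 3) F) = !![1, p.1.1, p.2; 0, 1, p.1.2; 0, 0, 1])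
include he

/-- **UNIPOTENT SHIFT OF THE CELL VALUE**: for `u = e((x,y′),z) ∈ U` and any `g`, `f(s₂ · x₁₂(y) · u · g) = f(s₂ · x₁₂(y + y′) · g)` (the left factor of §1 lies in `U`, where
`σ′ = 1`, ★ `inducingChar_apply_of_mem_upperUnitriangular`). [cite: BernsteinZelevinsky1977, Thm. 5.2] -/
theorem toFun_swap_coordOneTwo_mul_coord (f : SmoothInd (standardParabolicGL F (id : Fin 3 → Fin 3))
      (Representation.twist (((Representation.trivial ℂ (Π a : Fin 3, GL {i : Fin 3 // (id : Fin 3 → Fin 3) i = a} F) ℂ).twist χ).comp (leviProjection F (id : Fin 3 → Fin 3)))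
        (rootDeltaChar (standardParabolicGL F (id : Fin 3 → Fin 3)))))
    (y x y' z : F) (g : GL (Fin 3) F) :
    f.toFun ((permGL (Equiv.swap (1 : Fin 3) 2) : GL (Fin 3) F) * ((e ((0, y), 0) : ↥(unipotentRadicalGL F (id : Fin 3 → Fin 3))) : GL (Fin 3) F) *
        ((e ((x, y'), z) : ↥(unipotentRadicalGL F (id : Fin 3 → Fin 3))) : GL (Fin 3) F) * g) =
      f.toFun ((permGL (Equiv.swap (1 : Fin 3) 2) : GL (Fin 3) F) * ((e ((0, y + y'), 0) : ↥(unipotentRadicalGL F (id : Fin 3 → Fin 3))) : GL (Fin 3) F) * g) := by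
  have hU : ((e ((z - x * (y + y'), 0), x) : ↥(unipotentRadicalGL F (id : Fin 3 → Fin 3))) : GL (Fin 3) F) ∈ upperUnitriangular (Fin 3) F := (e _).2
  rw [permGL_swap_mul_coordOneTwo_mul_coord e he, mul_assoc _ (permGL (Equiv.swap (1 : Fin 3) 2) : GL (Fin 3) F), mul_assoc _ ((permGL (Equiv.swap (1 : Fin 3) 2) : GL (Fin 3) F) * _) g,
    show ((e ((z - x * (y + y'), 0), x) : ↥(unipotentRadicalGL F (id : Fin 3 → Fin 3))) : GL (Fin 3) F) =
      ((⟨_, unipotentRadicalGL_le F (id : Fin 3 → Fin 3) hU⟩ : ↥(standardParabolicGL F (id : Fin 3 → Fin 3))) : GL (Fin 3) F) from rfl,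
    SmoothInd.toFun_subgroup_mul, inducingChar_apply_of_mem_upperUnitriangular χ hU]

/-- The same for an abstract `u ∈ U` (its cell shift is the entry `u₁₂`). [cite: BernsteinZelevinsky1977, Thm. 5.2] -/
theorem toFun_swap_coordOneTwo_mul_unipotent (f : SmoothInd (standardParabolicGL F (id : Fin 3 → Fin 3))
      (Representation.twist (((Representation.trivial ℂ (Π a : Fin 3, GL {i : Fin 3 // (id : Fin 3 → Fin 3) i = a} F) ℂ).twist χ).comp (leviProjection F (id : Fin 3 → Fin 3)))
        (rootDeltaChar (standardParabolicGL F (id : Fin 3 → Fin 3)))))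
    (y : F) {u : GL (Fin 3) F} (hu : u ∈ upperUnitriangular (Fin 3) F) (g : GL (Fin 3) F) :
    f.toFun ((permGL (Equiv.swap (1 : Fin 3) 2) : GL (Fin 3) F) * ((e ((0, y), 0) : ↥(unipotentRadicalGL F (id : Fin 3 → Fin 3))) : GL (Fin 3) F) * u * g) =
      f.toFun ((permGL (Equiv.swap (1 : Fin 3) 2) : GL (Fin 3) F) * ((e ((0, y + (u : Matrix (Fin 3) (Fin 3) F) 1 2), 0) : ↥(unipotentRadicalGL F (id : Fin 3 → Fin 3))) : GL (Fin 3) F) * g) := by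
  conv_lhs => rw [eq_coord e he u hu]
  exact toFun_swap_coordOneTwo_mul_coord χ e he f y _ _ _ g

/-- **TORUS SCALING OF THE CELL VALUE**: `f(s₂ · x₁₂(y) · diag(m) · g) = σ′(s₂ diag(m) s₂⁻¹) · f(s₂ · x₁₂(y d₂∕d₁) · g)`, with the scalar written out as
`δ_B^{1∕2}(s₂ diag m s₂⁻¹) · χ(levi(s₂ diag m s₂⁻¹))`. [cite: BernsteinZelevinsky1977, 1.7, Thm. 5.2] -/
theorem toFun_swap_coordOneTwo_mul_blockDiagonalGL (f : SmoothInd (standardParabolicGL F (id : Fin 3 → Fin 3))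
      (Representation.twist (((Representation.trivial ℂ (Π a : Fin 3, GL {i : Fin 3 // (id : Fin 3 → Fin 3) i = a} F) ℂ).twist χ).comp (leviProjection F (id : Fin 3 → Fin 3)))
        (rootDeltaChar (standardParabolicGL F (id : Fin 3 → Fin 3)))))
    (y : F) (m : Π a : Fin 3, GL {i : Fin 3 // (id : Fin 3 → Fin 3) i = a} F) (g : GL (Fin 3) F) :
    f.toFun ((permGL (Equiv.swap (1 : Fin 3) 2) : GL (Fin 3) F) * ((e ((0, y), 0) : ↥(unipotentRadicalGL F (id : Fin 3 → Fin 3))) : GL (Fin 3) F) *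
        blockDiagonalGL F (id : Fin 3 → Fin 3) m * g) =
      (((rootDeltaChar (standardParabolicGL F (id : Fin 3 → Fin 3)) ⟨_, permGL_swap_conj_blockDiagonalGL_mem m⟩ : ℂˣ) : ℂ) *
        (((χ (leviProjection F (id : Fin 3 → Fin 3) ⟨_, permGL_swap_conj_blockDiagonalGL_mem m⟩)) : ℂˣ) : ℂ)) *
      f.toFun ((permGL (Equiv.swap (1 : Fin 3) 2) : GL (Fin 3) F) *
        ((e ((0, y * ((blockDiagonalGL F (id : Fin 3 → Fin 3) m : GL (Fin 3) F) : Matrix (Fin 3) (Fin 3) F) 2 2 / ((blockDiagonalGL F (id : Fin 3 → Fin 3) m : GL (Fin 3) F) : Matrix (Fin 3) (Fin 3) F) 1 1), 0) :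
          ↥(unipotentRadicalGL F (id : Fin 3 → Fin 3))) : GL (Fin 3) F) * g) := by
  rw [permGL_swap_mul_coordOneTwo_mul_blockDiagonalGL e he y m, mul_assoc _ (permGL (Equiv.swap (1 : Fin 3) 2) : GL (Fin 3) F),
    mul_assoc _ ((permGL (Equiv.swap (1 : Fin 3) 2) : GL (Fin 3) F) * _) g]
  refine (SmoothInd.toFun_subgroup_mul f ⟨_, permGL_swap_conj_blockDiagonalGL_mem m⟩ _).trans ?_
  rw [inducingChar_apply, ← mul_assoc]

end Values

/-! ## §3 The integrand on `X¹ = vanishingOn P`: the cells below `s₂` lie in `P`; compact support and continuity -/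

section Support

variable [ValuativeRel F] [TopologicalSpace F] [IsNonarchimedeanLocalField F]

omit [ValuativeRel F] [TopologicalSpace F] [IsNonarchimedeanLocalField F] in
/-- **The Borel cells below `s₂` lie in `P = P_{(2,1)}`**: `cellLT id s₂ ⊆ P` (a cell `B P_τ U` with `key τ < key s₂` has `rankSum τ ≤ rankSum s₂` and `τ ≠ s₂`, and then
`P_τ ∈ P` — a `decide` over `S₃`; `B, U ≤ P`). [cite: BernsteinZelevinsky1977, Thm. 5.2] -/
theorem cellLT_swap_one_two_subset_parabolic :
    cellLT (K := F) (id : Fin 3 → Fin 3) (Equiv.swap (1 : Fin 3) 2) ⊆ (standardParabolicGL F (![0, 0, 1] : Fin 3 → Fin 2) : Set (GL (Fin 3) F)) := by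
  intro g hg
  obtain ⟨τ, hτ, p, hp, u, hu, rfl⟩ := (mem_cellsBelow_iff (K := F) (id : Fin 3 → Fin 3) _ g).1 hg
  have hlt : cellKey (id : Fin 3 → Fin 3) τ < cellKey (id : Fin 3 → Fin 3) (Equiv.swap (1 : Fin 3) 2) := hτ
  have hne : τ ≠ Equiv.swap (1 : Fin 3) 2 := fun h => (ne_of_lt hlt) (by rw [h])
  have hrk := rankSum_le_of_cellKey_le (id : Fin 3 → Fin 3) hlt.le
  have key : ∀ τ : Equiv.Perm (Fin 3), rankSum (id : Fin 3 → Fin 3) τ ≤ rankSum (id : Fin 3 → Fin 3) (Equiv.swap (1 : Fin 3) 2) →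
      τ ≠ Equiv.swap (1 : Fin 3) 2 → ∀ i : Fin 3, (![0, 0, 1] : Fin 3 → Fin 2) i ≤ (![0, 0, 1] : Fin 3 → Fin 2) (τ i) := by decide
  have hτP : (permGL τ : GL (Fin 3) F) ∈ standardParabolicGL F (![0, 0, 1] : Fin 3 → Fin 2) := permGL_mem_standardParabolicGL _ (key τ hrk hne)
  have hBP : standardParabolicGL F (id : Fin 3 → Fin 3) ≤ standardParabolicGL F (![0, 0, 1] : Fin 3 → Fin 2) := standardParabolicGL_id_le_of_monotone K2E3GL3MaximalParabolicRelabel.monotone_twoOne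
  exact Subgroup.mul_mem _ (Subgroup.mul_mem _ (hBP hp) hτP) (hBP (unipotentRadicalGL_le F (id : Fin 3 → Fin 3) hu))

variable (χ : (Π a : Fin 3, GL {i : Fin 3 // (id : Fin 3 → Fin 3) i = a} F) →* ℂˣ)
  (e : (F × F) × F ≃ₜ ↥(unipotentRadicalGL F (id : Fin 3 → Fin 3)))
  (he : ∀ p : (F × F) × F, (((e p : ↥(unipotentRadicalGL F (id : Fin 3 → Fin 3))) : GL (Fin 3) F) : Matrix (Fin 3) (Fin 3) F) = !![1, p.1.1, p.2; 0, 1, p.1.2; 0, 0, 1])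
include he

omit [ValuativeRel F] [IsNonarchimedeanLocalField F] he in
/-- The integrand `y ↦ f(s₂ · x₁₂(y) · g)` is CONTINUOUS (the cell function of a smooth vector is locally constant, ★ `SmoothInd.isLocallyConstant_cellFun`).
[cite: BernsteinZelevinsky1977, §2.3] -/
theorem continuous_middleCellFun [IsTopologicalRing F] (σ' : Representation ℂ ↥(standardParabolicGL F (id : Fin 3 → Fin 3)) ℂ)
    (f : SmoothInd (standardParabolicGL F (id : Fin 3 → Fin 3)) σ') (g : GL (Fin 3) F) :
    Continuous fun y : F => f.toFun ((permGL (Equiv.swap (1 : Fin 3) 2) : GL (Fin 3) F) * ((e ((0, y), 0) : ↥(unipotentRadicalGL F (id : Fin 3 → Fin 3))) : GL (Fin 3) F) * g) := by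
  have h1 := (SmoothInd.isLocallyConstant_cellFun (MonoidHom.id (GL (Fin 3) F)) (permGL (Equiv.swap (1 : Fin 3) 2) : GL (Fin 3) F) continuous_id f).continuous
  have h2 : Continuous fun y : F => ((e ((0, y), 0) : ↥(unipotentRadicalGL F (id : Fin 3 → Fin 3))) : GL (Fin 3) F) * g :=
    (continuous_subtype_val.comp (e.continuous.comp (by fun_prop))).mul continuous_const
  simpa only [Function.comp_def, MonoidHom.id_apply, mul_assoc] using h1.comp h2

/-- **COMPACT SUPPORT OF THE INTEGRAND**: for `f ∈ X¹ = vanishingOn P` and `p ∈ P` the function `y ↦ f(s₂ · x₁₂(y) · p)` has compact support (`p·f ∈ X¹ ≤ vanishingOn (cellLT id s₂)`,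
★ E3γ1 `hasCompactSupport_cellFun_of_mem_vanishingOn_cellLT` with the cell datum of ★ E3β₁∕β₂, transported along `y ↦ x₁₂(y)`, ★ `exists_homeomorph_rootGroup_oneTwo`).
[cite: BernsteinZelevinsky1977, §5.14, Thm. 5.2] [cite: Casselman1995, §6.3] -/
theorem hasCompactSupport_middleCellFun (σ' : Representation ℂ ↥(standardParabolicGL F (id : Fin 3 → Fin 3)) ℂ)
    (f : SmoothInd (standardParabolicGL F (id : Fin 3 → Fin 3)) σ')
    (hf : f ∈ vanishingOn (standardParabolicGL F (id : Fin 3 → Fin 3)) σ' (standardParabolicGL F (![0, 0, 1] : Fin 3 → Fin 2) : Set (GL (Fin 3) F)))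
    {p : GL (Fin 3) F} (hp : p ∈ standardParabolicGL F (![0, 0, 1] : Fin 3 → Fin 2)) :
    HasCompactSupport fun y : F => f.toFun ((permGL (Equiv.swap (1 : Fin 3) 2) : GL (Fin 3) F) * ((e ((0, y), 0) : ↥(unipotentRadicalGL F (id : Fin 3 → Fin 3))) : GL (Fin 3) F) * p) := by
  haveI : IsTopologicalRing F := inferInstance
  -- `p · f ∈ X¹ ≤ vanishingOn (cellLT id s₂)`
  have hf' : smoothIndRep (standardParabolicGL F (id : Fin 3 → Fin 3)) σ' p f ∈ vanishingOn (standardParabolicGL F (id : Fin 3 → Fin 3)) σ' (cellLT (K := F) (id : Fin 3 → Fin 3) (Equiv.swap (1 : Fin 3) 2)) :=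
    vanishingOn_mono cellLT_swap_one_two_subset_parabolic
      (K2E3GL3BorelInducedJacquetQFiltration.smoothIndRep_mem_vanishingOn_of_mul_mem (![0, 0, 1] : Fin 3 → Fin 2) σ' _
        (K2E3GL3BorelInducedJacquetQFiltration.parabolic_mul_mem (![0, 0, 1] : Fin 3 → Fin 2)) hp hf)
  -- the cell datum of `s₂` (★ E3β₁∕β₂) and compact support of the cell function on `Γ = U_{α₂}`
  obtain ⟨-, hS, -, -⟩ := cellDatum_swap_one_two (F := F)
  obtain ⟨proj, hproj, hprojS⟩ := exists_proj_swap_one_two (F := F)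
  have hΓU := (rootSubgroups_le (F := F)).2.2.2
  have hcs := hasCompactSupport_cellFun_of_mem_vanishingOn_cellLT σ' (Equiv.swap (1 : Fin 3) 2) _ _ hΓU hS proj hproj hprojS _ hf'
  -- transport along `y ↦ x₁₂(y) ∈ Γ`
  obtain ⟨φ, hφ, -⟩ := exists_homeomorph_rootGroup_oneTwo e he
  have heq : (fun y : F => f.toFun ((permGL (Equiv.swap (1 : Fin 3) 2) : GL (Fin 3) F) * ((e ((0, y), 0) : ↥(unipotentRadicalGL F (id : Fin 3 → Fin 3))) : GL (Fin 3) F) * p)) =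
      (fun γ : ↥(unipotentRadicalGL F (![false, false, true] : Fin 3 → Bool) ⊓ standardLeviGL F (![false, true, true] : Fin 3 → Bool)) =>
        (smoothIndRep (standardParabolicGL F (id : Fin 3 → Fin 3)) σ' p f).toFun ((permGL (Equiv.swap (1 : Fin 3) 2) : GL (Fin 3) F) * (γ : GL (Fin 3) F))) ∘ φ := by
    funext y
    simp only [Function.comp_apply, toFun_smoothIndRep_apply, hφ]
  rw [heq]
  exact hcs.comp_homeomorph φ

/-- Hence the integrand is integrable for every measure finite on compacts. [cite: Casselman1995, §6.3] -/
theorem integrable_middleCellFun [MeasurableSpace F] [BorelSpace F] (μ : Measure F) [IsFiniteMeasureOnCompacts μ]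
    (σ' : Representation ℂ ↥(standardParabolicGL F (id : Fin 3 → Fin 3)) ℂ)
    (f : SmoothInd (standardParabolicGL F (id : Fin 3 → Fin 3)) σ')
    (hf : f ∈ vanishingOn (standardParabolicGL F (id : Fin 3 → Fin 3)) σ' (standardParabolicGL F (![0, 0, 1] : Fin 3 → Fin 2) : Set (GL (Fin 3) F)))
    {p : GL (Fin 3) F} (hp : p ∈ standardParabolicGL F (![0, 0, 1] : Fin 3 → Fin 2)) :
    Integrable (fun y : F => f.toFun ((permGL (Equiv.swap (1 : Fin 3) 2) : GL (Fin 3) F) * ((e ((0, y), 0) : ↥(unipotentRadicalGL F (id : Fin 3 → Fin 3))) : GL (Fin 3) F) * p)) μ :=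
  haveI : IsTopologicalRing F := inferInstance
  (continuous_middleCellFun e σ' f p).integrable_of_hasCompactSupport (hasCompactSupport_middleCellFun e he σ' f hf hp)

end Support

/-! ## §4 The middle-cell integrals: translation invariance under `U`, `U_P`-invariance, torus substitution -/

section Integrals

variable [ValuativeRel F] [TopologicalSpace F] [IsNonarchimedeanLocalField F] [MeasurableSpace F] [BorelSpace F] (μ : Measure F) [μ.IsAddHaarMeasure]
  (χ : (Π a : Fin 3, GL {i : Fin 3 // (id : Fin 3 → Fin 3) i = a} F) →* ℂˣ)
  (e : (F × F) × F ≃ₜ ↥(unipotentRadicalGL F (id : Fin 3 → Fin 3)))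
  (he : ∀ p : (F × F) × F, (((e p : ↥(unipotentRadicalGL F (id : Fin 3 → Fin 3))) : GL (Fin 3) F) : Matrix (Fin 3) (Fin 3) F) = !![1, p.1.1, p.2; 0, 1, p.1.2; 0, 0, 1])
include he

/-- **TRANSLATION INVARIANCE**: for `u ∈ U`, `∫ f(s₂ x₁₂(y) u g) dy = ∫ f(s₂ x₁₂(y) g) dy` (the integrand is the shift by `u₁₂`). [cite: BernsteinZelevinsky1977, 1.7, Thm. 5.2] -/
theorem integral_middleCellFun_mul_unipotent (f : SmoothInd (standardParabolicGL F (id : Fin 3 → Fin 3)) (Representation.twist (((Representation.trivial ℂ (Π a : Fin 3, GL {i : Fin 3 // (id : Fin 3 → Fin 3) i = a} F) ℂ).twist χ).comp (leviProjection F (id : Fin 3 → Fin 3))) (rootDeltaChar (standardParabolicGL F (id : Fin 3 → Fin 3)))))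
    {u : GL (Fin 3) F} (hu : u ∈ upperUnitriangular (Fin 3) F) (g : GL (Fin 3) F) :
    ∫ y, f.toFun ((permGL (Equiv.swap (1 : Fin 3) 2) : GL (Fin 3) F) * ((e ((0, y), 0) : ↥(unipotentRadicalGL F (id : Fin 3 → Fin 3))) : GL (Fin 3) F) * u * g) ∂μ = ∫ y, f.toFun ((permGL (Equiv.swap (1 : Fin 3) 2) : GL (Fin 3) F) * ((e ((0, y), 0) : ↥(unipotentRadicalGL F (id : Fin 3 → Fin 3))) : GL (Fin 3) F) * g) ∂μ := by
  simp_rw [toFun_swap_coordOneTwo_mul_unipotent χ e he f _ hu g]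
  exact integral_add_right_eq_self (fun y => f.toFun ((permGL (Equiv.swap (1 : Fin 3) 2) : GL (Fin 3) F) * ((e ((0, y), 0) : ↥(unipotentRadicalGL F (id : Fin 3 → Fin 3))) : GL (Fin 3) F) * g)) ((u : Matrix (Fin 3) (Fin 3) F) 1 2)

/-- **`U_P`-INVARIANCE OF THE MIDDLE-CELL INTEGRAL**: for `p ∈ P` and `u ∈ U_P`, `∫ (u·f)(s₂ x₁₂(y) p) dy = ∫ f(s₂ x₁₂(y) p) dy` (`p u p⁻¹ ∈ U_P ≤ U`, then translation
invariance). [cite: BernsteinZelevinsky1977, §2.3, Thm. 5.2] -/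
theorem integral_middleCellFun_smoothIndRep_unipotentRadical (f : SmoothInd (standardParabolicGL F (id : Fin 3 → Fin 3)) (Representation.twist (((Representation.trivial ℂ (Π a : Fin 3, GL {i : Fin 3 // (id : Fin 3 → Fin 3) i = a} F) ℂ).twist χ).comp (leviProjection F (id : Fin 3 → Fin 3))) (rootDeltaChar (standardParabolicGL F (id : Fin 3 → Fin 3)))))
    {p : GL (Fin 3) F} (hp : p ∈ standardParabolicGL F (![0, 0, 1] : Fin 3 → Fin 2)) {u : GL (Fin 3) F} (hu : u ∈ unipotentRadicalGL F (![0, 0, 1] : Fin 3 → Fin 2)) :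
    ∫ y, (smoothIndRep (standardParabolicGL F (id : Fin 3 → Fin 3)) (Representation.twist (((Representation.trivial ℂ (Π a : Fin 3, GL {i : Fin 3 // (id : Fin 3 → Fin 3) i = a} F) ℂ).twist χ).comp (leviProjection F (id : Fin 3 → Fin 3))) (rootDeltaChar (standardParabolicGL F (id : Fin 3 → Fin 3)))) u f).toFun ((permGL (Equiv.swap (1 : Fin 3) 2) : GL (Fin 3) F) * ((e ((0, y), 0) : ↥(unipotentRadicalGL F (id : Fin 3 → Fin 3))) : GL (Fin 3) F) * p) ∂μ =
      ∫ y, f.toFun ((permGL (Equiv.swap (1 : Fin 3) 2) : GL (Fin 3) F) * ((e ((0, y), 0) : ↥(unipotentRadicalGL F (id : Fin 3 → Fin 3))) : GL (Fin 3) F) * p) ∂μ := by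
  have hconj : p * u * p⁻¹ ∈ upperUnitriangular (Fin 3) F :=
    unipotentRadicalGL_le_upperUnitriangular (![0, 0, 1] : Fin 3 → Fin 2) K2E3GL3MaximalParabolicRelabel.monotone_twoOne (conj_mem_unipotentRadicalGL_of_mem_parabolic _ hp hu)
  have heq : ∀ y, (smoothIndRep (standardParabolicGL F (id : Fin 3 → Fin 3)) (Representation.twist (((Representation.trivial ℂ (Π a : Fin 3, GL {i : Fin 3 // (id : Fin 3 → Fin 3) i = a} F) ℂ).twist χ).comp (leviProjection F (id : Fin 3 → Fin 3))) (rootDeltaChar (standardParabolicGL F (id : Fin 3 → Fin 3)))) u f).toFun ((permGL (Equiv.swap (1 : Fin 3) 2) : GL (Fin 3) F) * ((e ((0, y), 0) : ↥(unipotentRadicalGL F (id : Fin 3 → Fin 3))) : GL (Fin 3) F) * p) =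
      f.toFun ((permGL (Equiv.swap (1 : Fin 3) 2) : GL (Fin 3) F) * ((e ((0, y), 0) : ↥(unipotentRadicalGL F (id : Fin 3 → Fin 3))) : GL (Fin 3) F) * (p * u * p⁻¹) * p) := fun y => by
    rw [toFun_smoothIndRep_apply]; congr 1; group
  simp_rw [heq]
  exact integral_middleCellFun_mul_unipotent μ χ e he f hconj p

/-- **TORUS SUBSTITUTION**: `∫ f(s₂ x₁₂(y) diag(m) g) dy = σ′(s₂ diag(m) s₂⁻¹) · ‖d₁∕d₂‖ · ∫ f(s₂ x₁₂(y) g) dy` (pointwise scaling §2, then `y ↦ (d₂∕d₁) y` of module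
`‖d₂∕d₁‖⁻¹`, ★ `map_mul_left_addHaar`). [cite: BernsteinZelevinsky1977, 1.7, Thm. 5.2] [cite: Casselman1995, §6.3] -/
theorem integral_middleCellFun_mul_blockDiagonalGL (f : SmoothInd (standardParabolicGL F (id : Fin 3 → Fin 3)) (Representation.twist (((Representation.trivial ℂ (Π a : Fin 3, GL {i : Fin 3 // (id : Fin 3 → Fin 3) i = a} F) ℂ).twist χ).comp (leviProjection F (id : Fin 3 → Fin 3))) (rootDeltaChar (standardParabolicGL F (id : Fin 3 → Fin 3)))))
    (m : Π a : Fin 3, GL {i : Fin 3 // (id : Fin 3 → Fin 3) i = a} F) (g : GL (Fin 3) F) :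
    ∫ y, f.toFun ((permGL (Equiv.swap (1 : Fin 3) 2) : GL (Fin 3) F) * ((e ((0, y), 0) : ↥(unipotentRadicalGL F (id : Fin 3 → Fin 3))) : GL (Fin 3) F) * blockDiagonalGL F (id : Fin 3 → Fin 3) m * g) ∂μ =
      (((rootDeltaChar (standardParabolicGL F (id : Fin 3 → Fin 3)) ⟨_, permGL_swap_conj_blockDiagonalGL_mem m⟩ : ℂˣ) : ℂ) *
        (((χ (leviProjection F (id : Fin 3 → Fin 3) ⟨_, permGL_swap_conj_blockDiagonalGL_mem m⟩)) : ℂˣ) : ℂ)) *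
      ((normAbs F (((blockDiagonalGL F (id : Fin 3 → Fin 3) m : GL (Fin 3) F) : Matrix (Fin 3) (Fin 3) F) 2 2 / ((blockDiagonalGL F (id : Fin 3 → Fin 3) m : GL (Fin 3) F) : Matrix (Fin 3) (Fin 3) F) 1 1)⁻¹ : ℝ≥0) : ℝ) *
      ∫ y, f.toFun ((permGL (Equiv.swap (1 : Fin 3) 2) : GL (Fin 3) F) * ((e ((0, y), 0) : ↥(unipotentRadicalGL F (id : Fin 3 → Fin 3))) : GL (Fin 3) F) * g) ∂μ := by
  haveI : T2Space F := (isLocalField F).toT2Space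
  haveI : LocallyCompactSpace F := (isLocalField F).toLocallyCompactSpace
  have hd1 := blockDiagonalGL_id_three_apply_ne_zero m 1
  have hd2 := blockDiagonalGL_id_three_apply_ne_zero m 2
  simp_rw [toFun_swap_coordOneTwo_mul_blockDiagonalGL χ e he f _ m g]
  rw [integral_const_mul]
  have hα : (((blockDiagonalGL F (id : Fin 3 → Fin 3) m : GL (Fin 3) F) : Matrix (Fin 3) (Fin 3) F) 2 2 / ((blockDiagonalGL F (id : Fin 3 → Fin 3) m : GL (Fin 3) F) : Matrix (Fin 3) (Fin 3) F) 1 1) ≠ 0 := div_ne_zero hd2 hd1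
  -- `∫ h(y α) dμ(y) = ‖α‖⁻¹ ∫ h dμ`
  have hsub : ∫ y, f.toFun ((permGL (Equiv.swap (1 : Fin 3) 2) : GL (Fin 3) F) * ((e ((0, y * ((blockDiagonalGL F (id : Fin 3 → Fin 3) m : GL (Fin 3) F) : Matrix (Fin 3) (Fin 3) F) 2 2 / ((blockDiagonalGL F (id : Fin 3 → Fin 3) m : GL (Fin 3) F) : Matrix (Fin 3) (Fin 3) F) 1 1), 0) : ↥(unipotentRadicalGL F (id : Fin 3 → Fin 3))) : GL (Fin 3) F) * g) ∂μ =
      (((normAbs F (((blockDiagonalGL F (id : Fin 3 → Fin 3) m : GL (Fin 3) F) : Matrix (Fin 3) (Fin 3) F) 2 2 / ((blockDiagonalGL F (id : Fin 3 → Fin 3) m : GL (Fin 3) F) : Matrix (Fin 3) (Fin 3) F) 1 1)⁻¹ : ℝ≥0) : ℝ) : ℂ) * ∫ y, f.toFun ((permGL (Equiv.swap (1 : Fin 3) 2) : GL (Fin 3) F) * ((e ((0, y), 0) : ↥(unipotentRadicalGL F (id : Fin 3 → Fin 3))) : GL (Fin 3) F) * g) ∂μ := by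
    have hmap := map_mul_left_addHaar μ hα
    have heq := integral_map_equiv ((Homeomorph.mulLeft₀ _ hα).toMeasurableEquiv) (fun x : F => f.toFun ((permGL (Equiv.swap (1 : Fin 3) 2) : GL (Fin 3) F) * ((e ((0, x), 0) : ↥(unipotentRadicalGL F (id : Fin 3 → Fin 3))) : GL (Fin 3) F) * g)) (μ := μ)
    rw [Homeomorph.toMeasurableEquiv_coe] at heq
    change ∫ x, f.toFun ((permGL (Equiv.swap (1 : Fin 3) 2) : GL (Fin 3) F) * ((e ((0, x), 0) : ↥(unipotentRadicalGL F (id : Fin 3 → Fin 3))) : GL (Fin 3) F) * g) ∂(μ.map (fun x => (((blockDiagonalGL F (id : Fin 3 → Fin 3) m : GL (Fin 3) F) : Matrix (Fin 3) (Fin 3) F) 2 2 / ((blockDiagonalGL F (id : Fin 3 → Fin 3) m : GL (Fin 3) F) : Matrix (Fin 3) (Fin 3) F) 1 1) * x)) = ∫ x, f.toFun ((permGL (Equiv.swap (1 : Fin 3) 2) : GL (Fin 3) F) * ((e ((0, (((blockDiagonalGL F (id : Fin 3 → Fin 3) m : GL (Fin 3) F) : Matrix (Fin 3) (Fin 3)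 F) 2 2 / ((blockDiagonalGL F (id : Fin 3 → Fin 3) m : GL (Fin 3) F) : Matrix (Fin 3) (Fin 3) F) 1 1) * x), 0) : ↥(unipotentRadicalGL F (id : Fin 3 → Fin 3))) : GL (Fin 3) F) * g) ∂μ at heq
    have hcomm : (fun y : F => f.toFun ((permGL (Equiv.swap (1 : Fin 3) 2) : GL (Fin 3) F) * ((e ((0, y * ((blockDiagonalGL F (id : Fin 3 → Fin 3) m : GL (Fin 3) F) : Matrix (Fin 3) (Fin 3) F) 2 2 / ((blockDiagonalGL F (id : Fin 3 → Fin 3) m : GL (Fin 3) F) : Matrix (Fin 3) (Fin 3) F) 1 1), 0) : ↥(unipotentRadicalGL F (id : Fin 3 → Fin 3))) : GL (Fin 3) F) * g)) = fun y => f.toFun ((permGL (Equiv.swap (1 : Fin 3) 2) : GL (Fin 3) F) * ((e ((0, (((blockDiagonalGL F (id : Fin 3 → Fin 3) m : GL (Fin 3) F) : Matrix (Fin 3) (Fin 3) F) 2 2 / ((blockDiagonalGL F (id : Fin 3 → Fin 3) m : GL (Fin 3) F) : Matrix (Fin 3) (Fin 3) F) 1 1) * y), 0) : ↥(unipotentRadicalGL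 F (id : Fin 3 → Fin 3))) : GL (Fin 3) F) * g) := by
      funext y; rw [mul_div_assoc, mul_comm y]
    rw [hcomm, ← heq, hmap, integral_smul_measure, ENNReal.coe_toReal, Complex.real_smul]
  rw [hsub, ← mul_assoc]

end Integrals

end Summit.HodgeConjecture.HodgeConjecture.Cruxes.H413.K2E3GL3BorelInducedJacquetQMiddleCellIntegrand

end
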